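import Summits.RiemannHypothesis.RiemannHypothesis.Theorems.LiAsymptoticDefs
import Literature.NumberTheory.LFunctions.ExplicitZeroFreeRegionProofs
import HarnessLib

/-!
# RiemannHypothesis / LI column — vocabulary PART J and the rung leaf L-P(P1-log):
# the Li HEIGHT LAW in the LOGARITHMIC range `n ≤ 2 T² log T` (Brown's range; RH-FREE)

Cell `pub/rh-li` (D-0040/D-0059/D-0061), theory round 6 (gen 8, 2026-08-26; dossier `theory/route/r6/README-R6.md`).
Statement-only module (`def`s + `@[conjecture]` targets + PROVED glue corollaries; no `sorry`, no axioms), the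
successor of PART C (`Theorems/LiAsymptoticDefs.lean`).

THE LAW.  Brown (J. Number Theory 111 (2005) 1–32, Thm 2) printed: if every zero of `ζ` with `|Im ρ| ≤ T` lies in
the lens `D_r`, `r = √(1 + T⁻²)` (implied by RH verified to height `T`), then `λ_n ≥ 0` for `1 ≤ n ≤ 2 T² log T`
(`T > T₀`, inexplicit).  The proof is incomplete: Droll (PhD thesis, Kansas State 2012, Conj. 1.7.10 and §5,
pp. 101–102) records that the power-series coefficients of `g(x) = (1+x)^{k/2} + (1+x)^{−k/2} − 2` used termwise in
Brown's Lemma 5 are not all non-negative, and Palojärvi (arXiv:1807.01506, §1) that «Brown's Theorem 2 is left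
unproved»; Oesterlé's range `n ≤ T²` is unpublished (Voros 2006, arXiv:math/0506326 §3; Bombieri–Lagarias 1999
footnote).  PART A's `LiHeightLawQuadratic` (`n ≤ T²/5`) and PART C's `LiAsymptoticLawQuadratic` (`n ≤ T²/4`) are
the tree's proved-range statements; the present leaf is Brown's LOGARITHMIC range with an explicit `T₀ = 1000`:

* `LiHeightLawLog` (LEAF L-P(P1-log)): `1000 ≤ T`, RH verified to `T` ⇒ `λ_n ≥ 0` for `1 ≤ n ≤ 2 T² log T`.
  RH-FREE and PROOF-OF-DATA: a finite verified height, finitely many `λ_n`; the zeros above `T` are controlled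
  unconditionally by COUNTING alone; nothing here bears on the truth of RH.
* `LiAsymptoticLawAllRange` (intermediate law the route assembles): RH to `T` ⇒ for EVERY `n ≥ 900`
  `|λ_n − (n/2) log n − C₁ n| ≤ 2 √n log n + liCoshDefect n T` — the quadratic-range law of PART C with the far-pair
  error replaced by the COSH DEFECT, valid with no restriction on `n` (it degrades gracefully: the defect is
  `≍ (n²/T³) log T` for `n ≤ T²` and `≍ e^{n/2T²} T log T` beyond, against a main term `(n/2) log n`).
* corollaries (PROVED from the leaf): `liPositivityPlattTrudgian26_of` (`λ_n ≥ 0` for `1 ≤ n ≤ 5·10²⁶` at the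
  Platt–Trudgian height `T = 3 000 175 332 800`, `2T² log T = 5.17·10²⁶`; PART A reached `1.8·10²⁴`),
  `liHeightLawQuadratic_of_log` (the leaf implies rung L-P(P1) `LiHeightLawQuadratic`).

MECHANISM (route `Theses/LiHeightLog.lean`; RH-free throughout).  Write `λ_n = lim_{T'} Re Σ_{liZeroBox T'}`
(`keiperLiCoeff_eq_zero_sum_holds`) and pair the zeros above `T` as `{ρ, 1 − ρ̄}` (`re_boxSum_eq`): the two members
have RECIPROCAL moduli `r, 1/r` of `1 − 1/ρ` and the SAME phase `φ`, so the pair contributes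
`m[2 − (rⁿ + r⁻ⁿ) cos nφ]` against the trace `2 m f_n(γ) = 2m(1 − cos nθ(γ))`; hence, with NO restriction on `n`,
`|pair − 2 m f_n(γ)| ≤ m[(rⁿ + r⁻ⁿ − 2) + 2n|φ − θ(γ)|] ≤ m[liCoshWeight n γ + n/(2γ³)]`
(`r^{±2} ≤ 1 + 1/γ²` for `0 ≤ Re ρ ≤ 1`; angle lemma `abs_arg_one_sub_inv_sub_liZeroAngle_le`) — crux LiBoxCosh,
replacing PART C's two-sided `2.82 n²/γ⁴` comparison (which needs `n ≤ γ²/4`).  The modulus defect is summed by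
COUNTING (crux LiCoshTailCount, Brown's Lemma 5 done by Stieltjes integration instead of power series):
`liCoshWeight n t ≤ 2(cosh(n/2t²) − 1) =: 2φ(t)` is decreasing in `t`, `φ ≤ −(t/2)φ'` (`cosh s − 1 ≤ s sinh s`), and
partial summation against `N(t) ≤ (t/2π) log(t/2πe) + 7/8 + 0.3083 log t + 4.128` (`abs_zetaZeroCount_sub_main_le_explicit`)
gives `Σ_{T<γ≤U} m liCoshWeight n γ ≤ φ(T)[T(log(T/2π) + 1)/π + 1.2332 log T + 17.13] ≤ liCoshTail n T`.
Everything else is PART C's proved machinery UNCHANGED (window above `√n`: `LiSmoothMainTerm`, `LiOscillatoryS`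
(plain Backlund form, `n ≥ 900`), `LiLowZerosTrivial`, `LiFarZeroTailCube`, `LiAsymptoticBudget` at
`T₁ = max(1000, 2√n)`), whence `LiAsymptoticLawAllRange`; the closed inequality
`2√n log n + liCoshDefect n T < liMainTerm n` on `900 ≤ n ≤ 2T² log T` (crux LiHeightBudgetLog; float margin: the
main term exceeds the defect 100-fold at `T = 1000`, 380-fold at the Platt–Trudgian height, growing like `log T`) and
`keiperLiCoeff_nonneg_of_riemannHypothesisUpTo` for `n < 900` give the leaf.

CEILING (recorded, not a target).  From RH to height `T` plus zero COUNTING alone no argument reaches beyond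
`n ≈ 2 T² log T (1 + o(1))`: an admissible configuration with `≍ log T` zeros at height `T⁺` and real parts `0, 1`
has modulus defect `≍ e^{n/2T²} log T` per unit, exceeding the main term `(n/2) log n` once `n > 2T² log T + O(T² log log T)`;
with an explicit zero-DENSITY input the constant `2` becomes at most `4`, and a single off-line quartet just above `T`
makes `λ_n < 0` at `n ≈ 4 T² log T`, so `c = 4` is the ceiling of every «RH to T ⇒ λ_n ≥ 0 for n ≤ c T² log T» law
over admissible zero multisets (Bombieri–Lagarias setting).  Brown's `c = 2` is thus the COUNTING-sharp constant.
-/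

noncomputable section

-- D-0017: `Summit.<S>.<S>.…` is the designed namespace of a single-problem summit.
set_option linter.dupNamespace false

namespace Summit.RiemannHypothesis.RiemannHypothesis.Theorems.LiTheory

open Literature.NumberTheory.LFunctions Literature.NumberTheory.LFunctions.SchoenfeldBound
open Literature.NumberTheory.DiophantineGeometry

/-! ## PART J — vocabulary of the cosh defect -/

/-- Brown's MODULUS-DEFECT WEIGHT `G_n(t) = (1 + 1/t²)^{n/2} + (1 + 1/t²)^{−n/2} − 2 = 2(cosh(n·½ log(1 + 1/t²)) − 1)`:
the largest value of `rⁿ + r⁻ⁿ − 2` over reflected pairs `{ρ, 1 − ρ̄}` of height `t` with `0 ≤ Re ρ ≤ 1`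
(`r = |1 − 1/ρ|`, `r^{±2} ≤ 1 + 1/t²`).  Brown 2005 Lemma 5; Droll 2012 §5 (`g`).  `G_n(t) ≤ 2(cosh(n/(2t²)) − 1)`. -/
def liCoshWeight (n : ℕ) (t : ℝ) : ℝ :=
  Real.sqrt (1 + 1 / t ^ 2) ^ n + (Real.sqrt (1 + 1 / t ^ 2) ^ n)⁻¹ - 2

/-- The RH-free COSH TAIL: an explicit bound for `Σ_{T < Im ρ ≤ U} m(ρ) G_n(Im ρ)` from zero COUNTING alone
(partial summation against `N(t) ≤ (t/2π) log(t/2πe) + 7/8 + 2(0.3083 log t + 4.128)`-increments, `φ ≤ −(t/2)φ'`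
for `φ(t) = cosh(n/2t²) − 1`, one integration by parts; derivation constants `1.2332 log T + 17.13` rounded up):
`liCoshTail n T = (cosh(n/(2T²)) − 1)·(T (log(T/2π) + 1)/π + 1.24 log T + 18)`. -/
def liCoshTail (n : ℕ) (T : ℝ) : ℝ :=
  (Real.cosh (n / (2 * T ^ 2)) - 1) * (T * (Real.log (T / (2 * Real.pi)) + 1) / Real.pi + 1.24 * Real.log T + 18)

/-- The total DEFECT above the verified height `T`: cosh tail (moduli) + phase tail `(n/2)·log T/(4πT²)`
(the PROVED `LiFarZeroTailCube`: `Σ_{Im ρ > T} m/(Im ρ)³ ≤ log T/(4πT²)`). -/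
def liCoshDefect (n : ℕ) (T : ℝ) : ℝ :=
  liCoshTail n T + n / 2 * (Real.log T / (4 * Real.pi * T ^ 2))

/-! ## The intermediate law, the rung leaf L-P(P1-log) and its corollaries -/

/-- **The Li ASYMPTOTIC LAW, ALL RANGES (RH-FREE; intermediate leaf assembled by route LiHeightLog)**: if every zero
of `ζ` with `0 < Im ρ ≤ T` (`T ≥ 1000`) lies on the critical line, then for EVERY `n ≥ 900`
`|λ_n − (n/2) log n − C₁ n| ≤ 2 √n log n + liCoshDefect n T`.  For `n ≤ T²` the defect is `O((n²/T³) log T)`; for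
`n = 2T² log T` it is still `≤ (main term)/100`.  Not in print (Lagarias 2007 Thm 1.1 is the RH-conditional
`O(√n log n)` for all `n`). [folklore] -/
@[conjecture] def LiAsymptoticLawAllRange : Prop :=
  ∀ ⦃T : ℝ⦄, 1000 ≤ T → RiemannHypothesisUpTo T → ∀ ⦃n : ℕ⦄, 900 ≤ n →
    |keiperLiCoeff n - liMainTerm n| ≤ 2 * Real.sqrt n * Real.log n + liCoshDefect n T

/-- **LEAF L-P(P1-log) «Li HEIGHT LAW, LOGARITHMIC RANGE» (RH-FREE; Brown's range with an explicit threshold)**: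
if every zero of `ζ` with `0 < Im ρ ≤ T` (`T ≥ 1000`) lies on the critical line, then `λ_n ≥ 0` for every
`1 ≤ n ≤ 2 T² log T`.  Brown 2005 Thm 2 states this for `T > T₀` (inexplicit) with an incomplete proof
(Droll 2012 Conj. 1.7.10, §5; Palojärvi 2020 §1); PART A's memo recorded it OPEN.  A FINITE verified height,
finitely many coefficients; PROOF-OF-DATA, never distance-to-summit (the RH-equivalent statement is `∀ n`).
Route `Theses/LiHeightLog.lean`. [folklore] -/
@[conjecture] def LiHeightLawLog : Prop :=
  ∀ ⦃T : ℝ⦄, 1000 ≤ T → RiemannHypothesisUpTo T →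
    ∀ ⦃n : ℕ⦄, 1 ≤ n → (n : ℝ) ≤ 2 * T ^ 2 * Real.log T → 0 ≤ keiperLiCoeff n

/-- **COROLLARY at the Platt–Trudgian height** (`riemannHypothesisUpTo_platt_trudgian`, `T = 3 000 175 332 800`,
`2 T² log T = 5.1719…·10²⁶`): `λ_n ≥ 0` for every `1 ≤ n ≤ 5·10²⁶`.  RH-FREE. [folklore] -/
@[conjecture] def LiPositivityPlattTrudgian26 : Prop :=
  riemannHypothesisUpTo_platt_trudgian → ∀ ⦃n : ℕ⦄, 1 ≤ n → n ≤ 500000000000000000000000000 → 0 ≤ keiperLiCoeff n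

/-- Glue (PROVED): the leaf gives the Platt–Trudgian corollary (`5·10²⁶ ≤ 2 T² · 28 ≤ 2 T² log T`). -/
theorem liPositivityPlattTrudgian26_of (h : LiHeightLawLog) : LiPositivityPlattTrudgian26 := by
  intro hPT n hn1 hn
  refine h (T := 3000175332800) (by norm_num) hPT hn1 ?_
  have h' : (n : ℝ) ≤ 500000000000000000000000000 := by exact_mod_cast hn
  refine h'.trans ?_
  have hlog := Literature.NumberTheory.LFunctions.le_log_plattTrudgianHeight
  nlinarith [hlog]

/-- Glue (PROVED): the logarithmic-range leaf implies rung L-P(P1) `LiHeightLawQuadratic` (`T ≥ 10⁵ ≥ 1000` and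
`T²/5 ≤ 2 T² log T` since `log T ≥ 1`). -/
theorem liHeightLawQuadratic_of_log (h : LiHeightLawLog) : LiHeightLawQuadratic := by
  intro T hT hRH n hn1 hn
  have hT' : (1000 : ℝ) ≤ T := le_trans (by norm_num) hT
  refine h hT' hRH hn1 (hn.trans ?_)
  have hTpos : 0 < T := by linarith
  have hlog : (1 : ℝ) ≤ Real.log T := by
    rw [Real.le_log_iff_exp_le hTpos]
    have : Real.exp 1 < 2.7182818286 := Real.exp_one_lt_d9
    linarith
  nlinarith [sq_nonneg T]

/-- Glue (PROVED): the all-range law plus a budget inequality on a range gives positivity on that range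
(the route's `closes` instantiates `B` with crux LiHeightBudgetLog's range `900 ≤ n ≤ 2T² log T`). -/
theorem keiperLiCoeff_pos_of_lawAllRange (h : LiAsymptoticLawAllRange) {T : ℝ} (hT : 1000 ≤ T)
    (hRH : RiemannHypothesisUpTo T) {n : ℕ} (hn : 900 ≤ n)
    (hband : 2 * Real.sqrt n * Real.log n + liCoshDefect n T < liMainTerm n) : 0 < keiperLiCoeff n := by
  have := abs_le.1 (h hT hRH hn)
  linarith [this.1]

end Summit.RiemannHypothesis.RiemannHypothesis.Theorems.LiTheory

end
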